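import Summits.FinalStateConjecture.FinalStateConjecture.Theorems.PhotonSphereChannelsBlindnessWaveEnergyBounds
import Summits.FinalStateConjecture.FinalStateConjecture.Theorems.PhotonSphereChannelsBlindnessAnsatz

/-!
# Route PhotonSphereChannels · BlindnessInsidePhotonSphere — the far-channel energy of a rest
# packet is controlled by the error energy of the frozen-oscillation ansatz

Support file (everything proved) for item stmt-FinalStateConjecture-10049; this is the analytic
heart of the proof. Let `ψ` be an even `C²` solution of `ψ_tt − ψ_xx + Vψ = 0` (`V ∈ C¹`,
`V ≥ 0`) with data `(A, 0)`, `A ∈ C²` supported in `[α, β]`, vanishing outside the domain of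
influence of `[α, β]`. Compare `ψ` with the ansatz `ψₐ = A(x) cos(ω₀ t)` (same Cauchy data, same
spatial support for all times, residual `((V − ω₀²)A − A'') cos(ω₀t)` bounded by `N`). If
`T > β − α` then for `|t| ≥ T` the energy of `ψ` in the far channel `{x > α + |t|}` is at most
`(e − 1) T² (β − α) N²` (`far_energy_le`):

  `∫_{x>α+|t|} e(t) ≤ ∫ χ(x−|t|) e(|t|) ≤ ∫ χ(x−T) e(T) ≤ ∫_{x>β} e(T) = ∫_{x>β} e_{ψ−ψₐ}(T) ≤ E_{ψ−ψₐ}(T)`,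

with a non-decreasing cut-off `χ` (`= 1` on `(α, ∞)`, `= 0` on `(−∞, α − (T − (β−α))]`), the
monotonicity of channel energies (`antitone_weightedEnergy`), the fact that `ψₐ ≡ 0` on
`{x > β}`, and the energy inequality for `ψ − ψₐ` (`energy_le_of_forcing`); negative times by
evenness. No definitions are introduced.
-/

noncomputable section

open Set Filter MeasureTheory Topology Function

namespace Summit.FinalStateConjecture.FinalStateConjecture.Theorems.Blindness

/-- `iteratedDeriv 2` of a difference of `C²` functions. -/
theorem iteratedDeriv_two_sub {f g : ℝ → ℝ} (hf : ContDiff ℝ 2 f) (hg : ContDiff ℝ 2 g) (x : ℝ) :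
    iteratedDeriv 2 (fun y => f y - g y) x = iteratedDeriv 2 f x - iteratedDeriv 2 g x := by
  have hf1 : ∀ y, HasDerivAt f (deriv f y) y := fun y => ((hf.differentiable (by norm_num)) y).hasDerivAt
  have hg1 : ∀ y, HasDerivAt g (deriv g y) y := fun y => ((hg.differentiable (by norm_num)) y).hasDerivAt
  have hf' : ContDiff ℝ 1 (deriv f) := by
    have h2 : ContDiff ℝ (1 + 1) f := by simpa [one_add_one_eq_two] using hf
    exact (contDiff_succ_iff_deriv.1 h2).2.2
  have hg' : ContDiff ℝ 1 (deriv g) := by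
    have h2 : ContDiff ℝ (1 + 1) g := by simpa [one_add_one_eq_two] using hg
    exact (contDiff_succ_iff_deriv.1 h2).2.2
  have hf2 : HasDerivAt (deriv f) (iteratedDeriv 2 f x) x := by
    rw [iteratedDeriv_succ, iteratedDeriv_one]; exact ((hf'.differentiable one_ne_zero) x).hasDerivAt
  have hg2 : HasDerivAt (deriv g) (iteratedDeriv 2 g x) x := by
    rw [iteratedDeriv_succ, iteratedDeriv_one]; exact ((hg'.differentiable one_ne_zero) x).hasDerivAt
  exact iteratedDeriv_two_eq_of_hasDerivAt (fun y => (hf1 y).sub (hg1 y)) (hf2.sub hg2)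

/-- Time lines and slices of a jointly `C²` field are `C²`. -/
theorem contDiff_two_lines {ψ : ℝ → ℝ → ℝ} (hψ : ContDiff ℝ 2 (uncurry ψ)) (t x : ℝ) :
    ContDiff ℝ 2 (fun τ => ψ τ x) ∧ ContDiff ℝ 2 (ψ t) :=
  ⟨hψ.comp (contDiff_id.prodMk contDiff_const), hψ.comp (contDiff_const.prodMk contDiff_id)⟩

/-- The energy density of an even field is even in time. -/
theorem energyDensity_even {ψ : ℝ → ℝ → ℝ} {V : ℝ → ℝ} (heven : ∀ t x, ψ (-t) x = ψ t x)
    (t x : ℝ) :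
    deriv (fun τ => ψ τ x) (-t) ^ 2 + deriv (ψ (-t)) x ^ 2 + V x * ψ (-t) x ^ 2
      = deriv (fun τ => ψ τ x) t ^ 2 + deriv (ψ t) x ^ 2 + V x * ψ t x ^ 2 := by
  have hfun : (fun τ => ψ τ x) = fun τ => ψ (-τ) x := funext fun τ => (heven τ x).symm
  have h1 : deriv (fun τ => ψ τ x) (-t) = -deriv (fun τ => ψ τ x) t := by
    conv_rhs => rw [hfun]
    rw [deriv_comp_neg (fun τ => ψ τ x) t]
    ring
  have h2 : ψ (-t) = ψ t := funext fun y => heven t y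
  rw [h1, h2]
  ring

section Far

variable {V : ℝ → ℝ} {ψ : ℝ → ℝ → ℝ} {A : ℝ → ℝ} {α β ω₀ T N : ℝ}

/-- **Far-channel energy bound.** See the module docstring. -/
theorem far_energy_le (hV1 : ContDiff ℝ 1 V) (hVnn : ∀ x, 0 ≤ V x)
    (hψ : ContDiff ℝ 2 (uncurry ψ))
    (hsol : ∀ t x, iteratedDeriv 2 (fun τ => ψ τ x) t - iteratedDeriv 2 (ψ t) x + V x * ψ t x = 0)
    (heven : ∀ t x, ψ (-t) x = ψ t x)
    (hsupp : ∀ t x, (x < α - |t| ∨ β + |t| < x) → ψ t x = 0)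
    (hψ0 : ∀ x, ψ 0 x = A x) (hψ1 : ∀ x, deriv (fun τ => ψ τ x) 0 = 0)
    (hA : ContDiff ℝ 2 A) (hA0 : ∀ x, (x < α ∨ β < x) → A x = 0)
    (hαβ : α ≤ β) (hT : β - α < T)
    (hres : ∀ t x, |((V x - ω₀ ^ 2) * A x - iteratedDeriv 2 A x) * Real.cos (ω₀ * t)| ≤ N) :
    ∀ t, T ≤ |t| → ∫ x in Ioi (α + |t|),
      (deriv (fun τ => ψ τ x) t ^ 2 + deriv (ψ t) x ^ 2 + V x * ψ t x ^ 2)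
        ≤ (Real.exp 1 - 1) * T ^ 2 * ((β - α) * N ^ 2) := by
  have hT0 : 0 < T := by linarith
  -- the ansatz and the error field
  obtain ⟨haC2, hat1, hax1, hares⟩ := ansatz_facts hA ω₀ V
  set ψa : ℝ → ℝ → ℝ := fun t x => A x * Real.cos (ω₀ * t) with hψa
  set φ : ℝ → ℝ → ℝ := fun t x => ψ t x - ψa t x with hφ
  have hφ2 : ContDiff ℝ 2 (uncurry φ) := hψ.sub haC2
  have hA0' : ∀ t x, (x < α - |t| ∨ β + |t| < x) → A x = 0 := by
    intro t x hx
    apply hA0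
    rcases hx with hx | hx
    · left; linarith [abs_nonneg t]
    · right; linarith [abs_nonneg t]
  have hφsupp : ∀ t x, (x < α - |t| ∨ β + |t| < x) → φ t x = 0 := by
    intro t x hx
    simp [hφ, hψa, hsupp t x hx, hA0' t x hx]
  have hφ0 : ∀ x, φ 0 x = 0 := fun x => by simp [hφ, hψa, hψ0 x]
  have hψline : ∀ x, HasDerivAt (fun τ => ψ τ x) 0 0 := by
    intro x
    have h := (hasDerivAt_time (hψ.of_le (by norm_num)) 0 x).differentiableAt.hasDerivAt
    rwa [hψ1 x] at h
  have hφ1 : ∀ x, deriv (fun τ => φ τ x) 0 = 0 := by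
    intro x
    have h := (hψline x).sub (hat1 0 x)
    have h' : HasDerivAt (fun τ => φ τ x) (0 - -(A x * ω₀ * Real.sin (ω₀ * 0))) 0 :=
      h.congr_of_eventuallyEq (Eventually.of_forall fun τ => rfl)
    rw [h'.deriv]; simp
  -- the residual of the error field
  have hφres : ∀ t x, iteratedDeriv 2 (fun τ => φ τ x) t - iteratedDeriv 2 (φ t) x + V x * φ t x
      = -(((V x - ω₀ ^ 2) * A x - iteratedDeriv 2 A x) * Real.cos (ω₀ * t)) := by
    intro t x
    obtain ⟨hψt, hψx⟩ := contDiff_two_lines hψ t x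
    obtain ⟨hat, hax⟩ := contDiff_two_lines haC2 t x
    have e1 : iteratedDeriv 2 (fun τ => φ τ x) t
        = iteratedDeriv 2 (fun τ => ψ τ x) t - iteratedDeriv 2 (fun τ => ψa τ x) t :=
      iteratedDeriv_two_sub hψt hat t
    have e2 : iteratedDeriv 2 (φ t) x = iteratedDeriv 2 (ψ t) x - iteratedDeriv 2 (ψa t) x :=
      iteratedDeriv_two_sub hψx hax x
    rw [e1, e2]
    have h1 := hsol t x
    have h2 := hares t x
    simp only [hψa] at h2 ⊢
    simp only [hφ, hψa]
    linear_combination h1 - h2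
  -- the forcing is supported in `[α, β]` and bounded by `N`
  have hG0 : ∀ t x, (x < α ∨ β < x) →
      ((V x - ω₀ ^ 2) * A x - iteratedDeriv 2 A x) * Real.cos (ω₀ * t) = 0 := by
    intro t x hx
    have hAev : A =ᶠ[𝓝 x] fun _ => (0 : ℝ) := by
      rcases hx with hx | hx
      · filter_upwards [Iio_mem_nhds hx] with y hy using hA0 y (Or.inl hy)
      · filter_upwards [Ioi_mem_nhds hx] with y hy using hA0 y (Or.inr hy)
    rw [hA0 x hx, iteratedDeriv_two_eq_zero_of_eventuallyEq hAev]; ring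
  have hN2 : ∀ t ∈ Icc 0 T, ∫ x, (iteratedDeriv 2 (fun τ => φ τ x) t - iteratedDeriv 2 (φ t) x
      + V x * φ t x) ^ 2 ≤ (β - α) * N ^ 2 := by
    intro t _
    have heq : (fun x => (iteratedDeriv 2 (fun τ => φ τ x) t - iteratedDeriv 2 (φ t) x
        + V x * φ t x) ^ 2)
        = fun x => (((V x - ω₀ ^ 2) * A x - iteratedDeriv 2 A x) * Real.cos (ω₀ * t)) ^ 2 := by
      funext x; rw [hφres t x]; ring
    rw [heq]
    have hzero : ∀ x, x ∉ Icc α β →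
        (((V x - ω₀ ^ 2) * A x - iteratedDeriv 2 A x) * Real.cos (ω₀ * t)) ^ 2 = 0 := by
      intro x hx
      have hx' : x < α ∨ β < x := by
        by_contra h
        exact hx ⟨le_of_not_gt fun h' => h (Or.inl h'), le_of_not_gt fun h' => h (Or.inr h')⟩
      rw [hG0 t x hx']; ring
    rw [← setIntegral_eq_integral_of_forall_compl_eq_zero hzero]
    have hb : ∀ x ∈ Icc α β,
        ‖(((V x - ω₀ ^ 2) * A x - iteratedDeriv 2 A x) * Real.cos (ω₀ * t)) ^ 2‖ ≤ N ^ 2 := by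
      intro x _
      rw [Real.norm_eq_abs, abs_pow]
      exact pow_le_pow_left₀ (abs_nonneg _) (hres t x) 2
    have h := norm_setIntegral_le_of_norm_le_const (μ := volume) (s := Icc α β)
      (by rw [Real.volume_Icc]; exact ENNReal.ofReal_lt_top) hb
    rw [Real.norm_eq_abs, Measure.real, Real.volume_Icc, ENNReal.toReal_ofReal (by linarith)] at h
    calc ∫ x in Icc α β, (((V x - ω₀ ^ 2) * A x - iteratedDeriv 2 A x) * Real.cos (ω₀ * t)) ^ 2
        ≤ |∫ x in Icc α β, (((V x - ω₀ ^ 2) * A x - iteratedDeriv 2 A x) * Real.cos (ω₀ * t)) ^ 2| :=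
          le_abs_self _
      _ ≤ N ^ 2 * (β - α) := h
      _ = (β - α) * N ^ 2 := by ring
  -- the energy inequality for the error field at time `T`
  have hEφ := energy_le_of_forcing hφ2 hV1 hVnn hφsupp hφ0 hφ1 hT0
    (mul_nonneg (by linarith) (sq_nonneg N)) hN2 T ⟨hT0.le, le_rfl⟩
  -- energy densities of `ψ`: non-negativity and integrability (in the statement's vocabulary)
  have hψ1' : ContDiff ℝ 1 (uncurry ψ) := hψ.of_le (by norm_num)
  have he_eq : ∀ s, (fun x => deriv (fun τ => ψ τ x) s ^ 2 + deriv (ψ s) x ^ 2 + V x * ψ s x ^ 2)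
      = fun x => fderiv ℝ (uncurry ψ) (s, x) (1, 0) ^ 2 + fderiv ℝ (uncurry ψ) (s, x) (0, 1) ^ 2
        + V x * ψ s x ^ 2 := fun s => funext fun x => energyDensity_eq hψ s x
  have he0 : ∀ s x, 0 ≤ deriv (fun τ => ψ τ x) s ^ 2 + deriv (ψ s) x ^ 2 + V x * ψ s x ^ 2 :=
    fun s x => by have := mul_nonneg (hVnn x) (sq_nonneg (ψ s x)); positivity
  have hcont : ∀ s, Continuous fun x => fderiv ℝ (uncurry ψ) (s, x) (1, 0) ^ 2
      + fderiv ℝ (uncurry ψ) (s, x) (0, 1) ^ 2 + V x * ψ s x ^ 2 := by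
    intro s
    have h1 := (continuous_fderiv_apply hψ (1, 0)).comp (Continuous.prodMk_right s)
    have h2 := (continuous_fderiv_apply hψ (0, 1)).comp (Continuous.prodMk_right s)
    have h3 := hψ.continuous.comp (Continuous.prodMk_right s)
    exact ((h1.pow 2).add (h2.pow 2)).add (hV1.continuous.mul (h3.pow 2))
  have hInt : ∀ s, Integrable fun x =>
      deriv (fun τ => ψ τ x) s ^ 2 + deriv (ψ s) x ^ 2 + V x * ψ s x ^ 2 := by
    intro s
    rw [he_eq s]
    exact integrable_of_fields (s := s) hψ hsupp (hcont s)
      (fun x h1 h2 h3 _ _ => by simp [h1, h2, h3])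
  -- the cut-off
  have hη : 0 < T - (β - α) := by linarith
  obtain ⟨χ, hχ1, hχ', hχ01, hχone, hχzero⟩ := exists_cutoff α hη
  have hχc : Continuous χ := hχ1.continuous
  have hIntχ : ∀ s, Integrable fun x => χ (x - s) *
      (deriv (fun τ => ψ τ x) s ^ 2 + deriv (ψ s) x ^ 2 + V x * ψ s x ^ 2) := by
    intro s
    have heqχ : (fun x => χ (x - s) *
        (deriv (fun τ => ψ τ x) s ^ 2 + deriv (ψ s) x ^ 2 + V x * ψ s x ^ 2))
        = fun x => χ (x - s) * (fderiv ℝ (uncurry ψ) (s, x) (1, 0) ^ 2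
          + fderiv ℝ (uncurry ψ) (s, x) (0, 1) ^ 2 + V x * ψ s x ^ 2) := by
      funext x; rw [energyDensity_eq hψ s x]
    rw [heqχ]
    exact integrable_of_fields (s := s) hψ hsupp
      ((hχc.comp (continuous_id.sub continuous_const)).mul (hcont s))
      (fun x h1 h2 h3 _ _ => by simp [h1, h2, h3])
  have hanti := antitone_weightedEnergy hψ hV1 hVnn hsupp hsol hχ1 hχ'
  -- `ψₐ ≡ 0` on `{x > β}`: there the densities of `ψ` and `φ` agree
  have hagree : ∀ x ∈ Ioi β,
      deriv (fun τ => ψ τ x) T ^ 2 + deriv (ψ T) x ^ 2 + V x * ψ T x ^ 2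
        = deriv (fun τ => φ τ x) T ^ 2 + deriv (φ T) x ^ 2 + V x * φ T x ^ 2 := by
    intro x hx
    have hAx : A x = 0 := hA0 x (Or.inr hx)
    have h1 : (fun τ => φ τ x) = fun τ => ψ τ x := by funext τ; simp [hφ, hψa, hAx]
    have h2 : φ T =ᶠ[𝓝 x] ψ T := by
      filter_upwards [Ioi_mem_nhds hx] with y hy
      simp [hφ, hψa, hA0 y (Or.inr hy)]
    have h3 : φ T x = ψ T x := by simp [hφ, hψa, hAx]
    rw [h1, h2.deriv_eq, h3]
  -- the chain of inequalities, for `s ≥ T`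
  have hchain : ∀ s, T ≤ s → ∫ x in Ioi (α + s),
      (deriv (fun τ => ψ τ x) s ^ 2 + deriv (ψ s) x ^ 2 + V x * ψ s x ^ 2)
        ≤ (Real.exp 1 - 1) * T ^ 2 * ((β - α) * N ^ 2) := by
    intro s hs
    calc ∫ x in Ioi (α + s), (deriv (fun τ => ψ τ x) s ^ 2 + deriv (ψ s) x ^ 2 + V x * ψ s x ^ 2)
        ≤ ∫ x, χ (x - s) * (deriv (fun τ => ψ τ x) s ^ 2 + deriv (ψ s) x ^ 2 + V x * ψ s x ^ 2) :=
          setIntegral_Ioi_le_integral_mul (hInt s) (hIntχ s) (he0 s) (fun x => (hχ01 _).1)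
            (fun x hx => hχone _ (by linarith))
      _ ≤ ∫ x, χ (x - T) * (deriv (fun τ => ψ τ x) T ^ 2 + deriv (ψ T) x ^ 2 + V x * ψ T x ^ 2) :=
          hanti hs
      _ ≤ ∫ x in Ioi β, (deriv (fun τ => ψ τ x) T ^ 2 + deriv (ψ T) x ^ 2 + V x * ψ T x ^ 2) :=
          integral_mul_le_setIntegral_Ioi (hInt T) (hIntχ T) (he0 T) (fun x => (hχ01 _).2)
            (fun x hx => hχzero _ (by linarith))
      _ = ∫ x in Ioi β, (deriv (fun τ => φ τ x) T ^ 2 + deriv (φ T) x ^ 2 + V x * φ T x ^ 2) :=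
          setIntegral_congr_fun measurableSet_Ioi hagree
      _ ≤ ∫ x, (deriv (fun τ => φ τ x) T ^ 2 + deriv (φ T) x ^ 2 + V x * φ T x ^ 2) := by
          refine setIntegral_le_integral ?_ (Eventually.of_forall fun x => ?_)
          · have heqφ : (fun x => deriv (fun τ => φ τ x) T ^ 2 + deriv (φ T) x ^ 2 + V x * φ T x ^ 2)
                = fun x => fderiv ℝ (uncurry φ) (T, x) (1, 0) ^ 2
                  + fderiv ℝ (uncurry φ) (T, x) (0, 1) ^ 2 + V x * φ T x ^ 2 :=
              funext fun x => energyDensity_eq hφ2 T x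
            rw [heqφ]
            have h1 := (continuous_fderiv_apply hφ2 (1, 0)).comp (Continuous.prodMk_right T)
            have h2 := (continuous_fderiv_apply hφ2 (0, 1)).comp (Continuous.prodMk_right T)
            have h3 := hφ2.continuous.comp (Continuous.prodMk_right T)
            exact integrable_of_fields (s := T) hφ2 hφsupp
              (((h1.pow 2).add (h2.pow 2)).add (hV1.continuous.mul (h3.pow 2)))
              (fun x h1 h2 h3 _ _ => by simp [h1, h2, h3])
          · have := mul_nonneg (hVnn x) (sq_nonneg (φ T x)); positivity
      _ ≤ (Real.exp 1 - 1) * T ^ 2 * ((β - α) * N ^ 2) := hEφ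
  -- all times `|t| ≥ T`, by evenness
  intro t ht
  rcases le_or_gt 0 t with ht0 | ht0
  · rw [abs_of_nonneg ht0] at ht ⊢
    exact hchain t ht
  · rw [abs_of_neg ht0] at ht ⊢
    have heq : ∀ x, deriv (fun τ => ψ τ x) t ^ 2 + deriv (ψ t) x ^ 2 + V x * ψ t x ^ 2
        = deriv (fun τ => ψ τ x) (-t) ^ 2 + deriv (ψ (-t)) x ^ 2 + V x * ψ (-t) x ^ 2 := by
      intro x
      have h := energyDensity_even (V := V) heven (-t) x
      simp only [neg_neg] at h
      exact h
    rw [setIntegral_congr_fun measurableSet_Ioi (fun x _ => heq x)]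
    exact hchain (-t) ht

end Far

end Summit.FinalStateConjecture.FinalStateConjecture.Theorems.Blindness

end
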